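import Literature.AlgebraicGeometry.AbelianSchemes.AbelianSchemeBaseQuotientDescent
import Literature.AlgebraicGeometry.Motives.FiniteQuotientProjective
import HarnessLib

/-!
# An abelian scheme with a finite-group action covering a free action on the base descends to the quotient of the base —
# the TOTAL-SPACE QUOTIENT supplied by Mumford's quotient of a quasi-projective scheme
# ([MumfordFogartyKirwan1994] Ch. 7 §3, remark after Thm. 7.9 / Lemma 7.11; [MumfordAV1970] §7 Thm. p. 66)

Cell `hodgecm-mathlib` (D-0151), F-DAG F-10 (b) TAIL «(10a)-ON-Q» FILE A (B-plan1 (g16) 07:35:53Z / 07:40:03Z; census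
`B-provers/B-p13/g19/CENSUS-F10b-10aOnQ.B-p13g19.md`).  PROOF lane, theorems only (no definition, no named fact, no instance,
no `sorry`).

★ `AbelianSchemeOver.exists_grpObj_isBaseChangeVia_of_free_base_quotient` ([MFK94] Lemma 7.11 in the tree's currency)
descends an abelian scheme `A → M` along a free affine geometric quotient `p : M → Q = M/G` of the base PROVIDED the quotient
`π : A → B₀` of the TOTAL SPACE by the covering `G`-action is given (an affine geometric quotient with separated `B₀ → Q`).
This file SUPPLIES that total-space quotient when everything lives over a field `k` and the total space of `A` is
QUASI-PROJECTIVE over `k` ([MumfordAV1970] §7 Thm. p. 66: a finite group acting on a quasi-projective scheme has a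
quotient — every orbit lies in an affine open; tree ★ `Motives.finiteQuotient` + ★
`ActionOver.forall_exists_stableAffineOpen_of_isQuasiProjectiveOver`), and packages the descent:

* `exists_desc_finiteQuotient_mk` — the construction: for an action `ρ₀` of `G` on the `k`-scheme `A → M → Spec k` with
  `(ρ₀ g) = autA g` and a `G`-stable affine open cover `hcov`, Mumford's ★ `Motives.finiteQuotient.mk ρ₀ hcov : A → A/G`
  is a geometric quotient for the action over it, and `A → M → Q` factors through `b : A/G → Q` over `k`;
* `exists_totalSpace_quotient_of_isQuasiProjectiveOver` — for `p : M → Q` over `k` with `ρ : ActionOver p.left G`, an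
  abelian scheme `A/M` whose total space is quasi-projective over `k`, and `autA : G →* Aut A` with
  `hA : ∀ g, A.IsBaseChangeVia A (ρ g) (autA g)` (the action COVERS `ρ` and respects the group law): there are a separated
  `k`-scheme `B₀`, `b : B₀ → Q`, an AFFINE (indeed finite) GEOMETRIC QUOTIENT `π : A → B₀` for the action `autA` over `π`,
  with `A.hom ≫ p = π ≫ b`;
* **`exists_abelianScheme_desc_of_isQuasiProjectiveOver`** — if moreover `p` is a FREE affine geometric quotient
  (`hq`, `hfree`), then `A` DESCENDS: an abelian scheme `B` over `Q` with `π : A → B` exhibiting `A ≅ M ×_Q B` as group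
  schemes (★ `IsBaseChangeVia`), the `G`-action on `A` over `π` (`ρA`, with `(ρA g) = autA g`) an affine geometric quotient;
* `exists_totalSpace_quotient_of_isQuasiProjectiveOver₀`, **`exists_abelianScheme_desc_of_isQuasiProjectiveOver₀`** — over
  a field `k : Type` (universe `0`, e.g. `k = ℚ`, the Siegel consumer) the same with ONE MORE CONJUNCT: the descended total
  space is QUASI-PROJECTIVE over `k` (★ `Motives.isQuasiProjectiveOver_finiteQuotient`, [MumfordAV1970] §7 Remark p. 69) —
  the (F) clause «universal family quasi-projective» for the level-descended Siegel datum (B-p02 (g13) 07:43:34Z).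

Consumer: FILE B `ModuliOfAbelianVarieties/SiegelFineModuliSchemeLevelGroupQuotientUniversal` (twice: for the universal
`A` and for its dual `Â`, feeding ★ `PolarizedAbelianSchemeWithLevel.exists_triple_desc_of_free_base_quotient`).
HC_CM is proved only modulo the 7 printed citations until rung 0 closes; count-neutral F-DAG capital.

## References
* [MumfordFogartyKirwan1994] D. Mumford, J. Fogarty, F. Kirwan, *Geometric Invariant Theory*, 3rd ed. (1994), Ch. 7 §1
  Prop. 7.1 (p. 127); Ch. 7 §3, remark after Thm. 7.9 and Lemma 7.11 (pp. 139–140).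
* [MumfordAV1970] D. Mumford, *Abelian Varieties* (1970), §7 Thm. p. 66 and Remark p. 69 (quotients of quasi-projective
  schemes by finite groups exist and are quasi-projective).
* [SGA1] A. Grothendieck, *SGA 1*, Exp. V Prop. 1.8, Exp. VIII Cor. 7.8.
-/

noncomputable section

universe u

open CategoryTheory CategoryTheory.Limits AlgebraicGeometry

namespace Literature.AlgebraicGeometry.AbelianSchemes.AbelianSchemeOver

open Literature.AlgebraicGeometry.RelativeSpec Literature.AlgebraicGeometry.RelativeSpec.ActionOver
  Literature.AlgebraicGeometry.Motives Literature.AlgebraicGeometry.HodgeTheory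

section AnyUniverse

variable {k : Type u} [Field k] {M Q : SchemeOver k} (p : M ⟶ Q) {G : Type u} [Group G] [Fintype G]
  (ρ : ActionOver p.left G) [IsSeparated Q.hom] (A : AbelianSchemeOver M.left) (autA : G →* Aut A.X.left)

/-- **THE CONSTRUCTION** ([MumfordAV1970] §7 Thm. p. 66; [MumfordFogartyKirwan1994] Ch. 7 §3).  For `p : M → Q` over `k`
(`Q` separated over `k`), `ρ` an action of `G` on `M` over `p`, an abelian scheme `A → M` with a `G`-action `autA` on its
total space covering `ρ` (`hsq`), an action `ρ₀` of `G` on the `k`-scheme `A → M → Spec k` with `(ρ₀ g) = autA g`, and a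
`G`-stable affine open cover `hcov` of `A`: Mumford's quotient map ★ `Motives.finiteQuotient.mk ρ₀ hcov : A → A/G` is a
GEOMETRIC QUOTIENT for the action viewed over it (`ρA`, `(ρA g) = autA g`), and `A → M → Q`, being `G`-invariant, factors
as `A → A/G → Q` with `b : A/G → Q` a `k`-morphism. [cite: MumfordAV1970, §7 Thm. p. 66]
[cite: MumfordFogartyKirwan1994, Ch. 7 §3, remark after Thm. 7.9 and Lemma 7.11 (pp. 139–140)] -/
theorem exists_desc_finiteQuotient_mk (hsq : ∀ g : G, (autA g).hom ≫ A.X.hom = A.X.hom ≫ (ρ.aut g).hom)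
    (ρ₀ : ActionOver (Over.mk (A.X.hom ≫ M.hom) : SchemeOver k).hom G) (hρ₀ : ∀ g : G, (ρ₀.aut g).hom = (autA g).hom)
    [IsSeparated (Over.mk (A.X.hom ≫ M.hom) : SchemeOver k).hom]
    (hcov : ∀ x : (Over.mk (A.X.hom ≫ M.hom) : SchemeOver k).left, ∃ O : ρ₀.StableAffineOpens, x ∈ O.1) :
    ∃ (b : (finiteQuotient ρ₀).left ⟶ Q.left) (ρA : ActionOver (finiteQuotient.mk ρ₀ hcov).left G),
      (∀ g : G, (ρA.aut g).hom = (autA g).hom) ∧ ρA.IsGeometricQuotient (finiteQuotient.mk ρ₀ hcov).left ∧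
        A.X.hom ≫ p.left = (finiteQuotient.mk ρ₀ hcov).left ≫ b ∧ b ≫ Q.hom = (finiteQuotient ρ₀).hom := by
  haveI : (finiteQuotient ρ₀).left.IsSeparated :=
    ⟨by rw [← terminal.comp_from (finiteQuotient ρ₀).hom]; haveI := isSeparated_finiteQuotient_hom ρ₀ hcov; infer_instance⟩
  haveI : Q.left.IsSeparated := ⟨by rw [← terminal.comp_from Q.hom]; infer_instance⟩
  -- the quotient map is invariant, and a geometric quotient for the action over it
  have hinv : ∀ g : G, (ρ₀.aut g).hom ≫ (finiteQuotient.mk ρ₀ hcov).left = (finiteQuotient.mk ρ₀ hcov).left := fun g => by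
    have h := congrArg CommaMorphism.left (finiteQuotient.overIso_hom_mk ρ₀ hcov g)
    simp only [Over.comp_left, ActionOver.overIso_hom_left] at h
    exact h
  let ρA : ActionOver (finiteQuotient.mk ρ₀ hcov).left G := ⟨ρ₀.aut, hinv⟩
  have hπ : ρA.IsGeometricQuotient (finiteQuotient.mk ρ₀ hcov).left :=
    (ρ₀.isGeometricQuotient_overMap_iff _ hinv _).mpr (ρ₀.isGeometricQuotient_gluedMk hcov)
  -- `A → M → Q` is `G`-invariant, hence factors through the quotient (over `k`)
  let f : (Over.mk (A.X.hom ≫ M.hom) : SchemeOver k) ⟶ Q := Over.homMk (A.X.hom ≫ p.left) (by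
    change (A.X.hom ≫ p.left) ≫ Q.hom = A.X.hom ≫ M.hom
    rw [Category.assoc, Over.w p])
  have hf : ∀ g : G, (ρ₀.overIso g).hom ≫ f = f := fun g => by
    ext : 1
    rw [Over.comp_left, ActionOver.overIso_hom_left, hρ₀ g]
    change (autA g).hom ≫ A.X.hom ≫ p.left = A.X.hom ≫ p.left
    rw [← Category.assoc, hsq g, Category.assoc, ρ.aut_comp g]
  refine ⟨(finiteQuotient.desc ρ₀ hcov f hf).left, ρA, hρ₀, hπ, ?_, Over.w (finiteQuotient.desc ρ₀ hcov f hf)⟩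
  have h := congrArg CommaMorphism.left (finiteQuotient.mk_desc ρ₀ hcov f hf)
  exact h.symm

variable [IsSeparated M.hom] (hA : ∀ g : G, A.IsBaseChangeVia A (ρ.aut g).hom (autA g).hom)
  (hqpA : IsQuasiProjectiveOver (Over.mk (A.X.hom ≫ M.hom) : SchemeOver k))

include hA hqpA

/-- **THE TOTAL-SPACE QUOTIENT** ([MumfordAV1970] §7 Thm. p. 66).  Over a field `k`: for `p : M → Q` a `k`-morphism of
separated `k`-schemes, `ρ` an action of the finite group `G` on `M` over `p`, an abelian scheme `A → M` whose total space is
quasi-projective over `k`, and a `G`-action `autA` on the total space covering `ρ` compatibly with the group law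
(`hA : A.IsBaseChangeVia A (ρ g) (autA g)`), Mumford's quotient of the total space by `G` exists: a separated `k`-scheme `B₀`
with `b : B₀ → Q`, and an AFFINE, indeed FINITE, GEOMETRIC QUOTIENT `π : A → B₀` of the action (viewed over `π`) with
`A.hom ≫ p = π ≫ b` — every point of the quasi-projective `A` lies in a `G`-stable affine open
(★ `ActionOver.forall_exists_stableAffineOpen_of_isQuasiProjectiveOver`). [cite: MumfordAV1970, §7 Thm. p. 66]
[cite: MumfordFogartyKirwan1994, Ch. 7 §3, remark after Thm. 7.9 and Lemma 7.11 (pp. 139–140)] -/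
theorem exists_totalSpace_quotient_of_isQuasiProjectiveOver :
    ∃ (B₀ : Scheme.{u}) (b : B₀ ⟶ Q.left) (π : A.X.left ⟶ B₀) (ρA : ActionOver π G),
      (∀ g : G, (ρA.aut g).hom = (autA g).hom) ∧ ρA.IsGeometricQuotient π ∧ IsAffineHom π ∧ IsFinite π ∧
        B₀.IsSeparated ∧ A.X.hom ≫ p.left = π ≫ b := by
  have hsq : ∀ g : G, (autA g).hom ≫ A.X.hom = A.X.hom ≫ (ρ.aut g).hom := fun g => (hA g).fst
  have hρk : ∀ g : G, (ρ.aut g).hom ≫ M.hom = M.hom := fun g => by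
    rw [← Over.w p, ← Category.assoc, ρ.aut_comp g]
  -- the action on the total space as a `k`-scheme
  let ρ₀ : ActionOver (Over.mk (A.X.hom ≫ M.hom) : SchemeOver k).hom G := ⟨autA, fun g => by
    change (autA g).hom ≫ A.X.hom ≫ M.hom = A.X.hom ≫ M.hom
    rw [← Category.assoc, hsq g, Category.assoc, hρk g]⟩
  haveI : IsProper A.X.hom := A.isProper
  haveI : IsSeparated (Over.mk (A.X.hom ≫ M.hom) : SchemeOver k).hom :=
    inferInstanceAs (IsSeparated (A.X.hom ≫ M.hom))
  haveI : LocallyOfFiniteType (Over.mk (A.X.hom ≫ M.hom) : SchemeOver k).hom :=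
    hqpA.isVarietyPair_ofScheme.locallyOfFiniteType
  -- every point lies in a `G`-stable affine open (quasi-projectivity), so Mumford's quotient exists
  have hcov := ρ₀.forall_exists_stableAffineOpen_of_isQuasiProjectiveOver hqpA
  obtain ⟨b, ρA, hρA, hπ, hb, -⟩ := exists_desc_finiteQuotient_mk p ρ A autA hsq ρ₀ (fun _ => rfl) hcov
  haveI := isSeparated_finiteQuotient_hom ρ₀ hcov
  exact ⟨(finiteQuotient ρ₀).left, b, (finiteQuotient.mk ρ₀ hcov).left, ρA, hρA, hπ,
    finiteQuotient.isAffineHom_mk_left ρ₀ hcov, finiteQuotient.isFinite_mk_left ρ₀ hcov,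
    ⟨by rw [← terminal.comp_from (finiteQuotient ρ₀).hom]; infer_instance⟩, hb⟩

variable {p ρ}
variable (hq : ρ.IsGeometricQuotient p.left) [IsAffineHom p.left]
  (hfree : ∀ (V : Q.left.Opens), IsAffineOpen V → ∀ g : G, g ≠ 1 →
    Ideal.span (Set.range fun s : Γ(M.left, p.left ⁻¹ᵁ V) ↦ ρ.act g V s - s) = ⊤)

include hq hfree

/-- **AN ABELIAN SCHEME WHOSE TOTAL SPACE IS QUASI-PROJECTIVE DESCENDS ALONG A FREE FINITE QUOTIENT OF THE BASE**
([MumfordFogartyKirwan1994] Ch. 7 §3, remark after Thm. 7.9 and Lemma 7.11).  Over a field `k`: `p : M → Q` a FREE affine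
geometric quotient by the finite group `G` (`hq`, `hfree`) of separated `k`-schemes; `A → M` an abelian scheme with
quasi-projective total space and a `G`-action `autA` covering `ρ` compatibly with the group law.  Then there is an abelian
scheme `B` over `Q` and an affine (indeed finite) geometric quotient `π : A → B` of the `G`-action (`ρA`, `(ρA g) = autA g`)
which exhibits `A` as the base change `M ×_Q B` AS A GROUP SCHEME (★ `IsBaseChangeVia`) — the total-space quotient of
`exists_totalSpace_quotient_of_isQuasiProjectiveOver` fed into ★ `exists_grpObj_isBaseChangeVia_of_free_base_quotient`.
[cite: MumfordFogartyKirwan1994, Ch. 7 §3, remark after Thm. 7.9 and Lemma 7.11 (pp. 139–140)]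
[cite: MumfordFogartyKirwan1994, Ch. 7 §1 Prop. 7.1 (p. 127)] [cite: MumfordAV1970, §7 Thm. p. 66] -/
theorem exists_abelianScheme_desc_of_isQuasiProjectiveOver :
    ∃ (B : AbelianSchemeOver Q.left) (π : A.X.left ⟶ B.X.left) (ρA : ActionOver π G),
      (∀ g : G, (ρA.aut g).hom = (autA g).hom) ∧ ρA.IsGeometricQuotient π ∧ IsAffineHom π ∧ IsFinite π ∧
        B.X.left.IsSeparated ∧ A.IsBaseChangeVia B p.left π := by
  obtain ⟨B₀, b, π, ρA, hρA, hπ, haff, hfin, hsep, hb⟩ :=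
    exists_totalSpace_quotient_of_isQuasiProjectiveOver p ρ A autA hA hqpA
  haveI := haff
  haveI := hsep
  have hA' : ∀ g : G, A.IsBaseChangeVia A (ρ.aut g).hom (ρA.aut g).hom := fun g => by
    rw [hρA g]
    exact hA g
  obtain ⟨grp, hpr, hsm, hgc, hbc⟩ := exists_grpObj_isBaseChangeVia_of_free_base_quotient hq hfree A hπ hA' b hb
  exact ⟨@AbelianSchemeOver.mk Q.left (Over.mk b) grp hpr hsm hgc, π, ρA, hρA, hπ, haff, hfin, hsep, hbc⟩

end AnyUniverse

/-! ### Over a field in `Type` (e.g. `ℚ`): the descended total space is quasi-projective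

★ `Motives.isQuasiProjectiveOver_finiteQuotient` ([MumfordAV1970] §7 Remark p. 69) is stated for groups `G : Type`; with
★ `exists_grpObj_isBaseChangeVia_of_free_base_quotient` (`G : Type u`, `u` the universe of the schemes) the two meet over
fields `k : Type` — the case of every consumer (`k = ℚ`, `G = Δ ≤ GSp_{2g}(ℤ/N)`). -/

section SmallField

variable {k : Type} [Field k] {M Q : SchemeOver k} (p : M ⟶ Q) {G : Type} [Group G] [Fintype G]
  (ρ : ActionOver p.left G) [IsSeparated Q.hom] [IsSeparated M.hom] (A : AbelianSchemeOver M.left)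
  (autA : G →* Aut A.X.left) (hA : ∀ g : G, A.IsBaseChangeVia A (ρ.aut g).hom (autA g).hom)
  (hqpA : IsQuasiProjectiveOver (Over.mk (A.X.hom ≫ M.hom) : SchemeOver k))

include hA hqpA

/-- **The total-space quotient, with quasi-projectivity** (`k : Type`): as
`exists_totalSpace_quotient_of_isQuasiProjectiveOver`, and moreover the quotient `B₀ → Q → Spec k` is QUASI-PROJECTIVE over
`k` ([MumfordAV1970] §7 Remark p. 69, ★ `Motives.isQuasiProjectiveOver_finiteQuotient`).
[cite: MumfordAV1970, §7 Thm. p. 66 and Remark p. 69]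
[cite: MumfordFogartyKirwan1994, Ch. 7 §3, remark after Thm. 7.9 and Lemma 7.11 (pp. 139–140)] -/
theorem exists_totalSpace_quotient_of_isQuasiProjectiveOver₀ :
    ∃ (B₀ : Scheme.{0}) (b : B₀ ⟶ Q.left) (π : A.X.left ⟶ B₀) (ρA : ActionOver π G),
      (∀ g : G, (ρA.aut g).hom = (autA g).hom) ∧ ρA.IsGeometricQuotient π ∧ IsAffineHom π ∧ IsFinite π ∧
        B₀.IsSeparated ∧ A.X.hom ≫ p.left = π ≫ b ∧ IsQuasiProjectiveOver (Over.mk (b ≫ Q.hom) : SchemeOver k) := by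
  have hsq : ∀ g : G, (autA g).hom ≫ A.X.hom = A.X.hom ≫ (ρ.aut g).hom := fun g => (hA g).fst
  have hρk : ∀ g : G, (ρ.aut g).hom ≫ M.hom = M.hom := fun g => by
    rw [← Over.w p, ← Category.assoc, ρ.aut_comp g]
  let ρ₀ : ActionOver (Over.mk (A.X.hom ≫ M.hom) : SchemeOver k).hom G := ⟨autA, fun g => by
    change (autA g).hom ≫ A.X.hom ≫ M.hom = A.X.hom ≫ M.hom
    rw [← Category.assoc, hsq g, Category.assoc, hρk g]⟩
  haveI : IsProper A.X.hom := A.isProper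
  haveI : IsSeparated (Over.mk (A.X.hom ≫ M.hom) : SchemeOver k).hom :=
    inferInstanceAs (IsSeparated (A.X.hom ≫ M.hom))
  haveI : LocallyOfFiniteType (Over.mk (A.X.hom ≫ M.hom) : SchemeOver k).hom :=
    hqpA.isVarietyPair_ofScheme.locallyOfFiniteType
  have hcov := ρ₀.forall_exists_stableAffineOpen_of_isQuasiProjectiveOver hqpA
  obtain ⟨b, ρA, hρA, hπ, hb, hbk⟩ := exists_desc_finiteQuotient_mk p ρ A autA hsq ρ₀ (fun _ => rfl) hcov
  haveI := isSeparated_finiteQuotient_hom ρ₀ hcov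
  refine ⟨(finiteQuotient ρ₀).left, b, (finiteQuotient.mk ρ₀ hcov).left, ρA, hρA, hπ,
    finiteQuotient.isAffineHom_mk_left ρ₀ hcov, finiteQuotient.isFinite_mk_left ρ₀ hcov,
    ⟨by rw [← terminal.comp_from (finiteQuotient ρ₀).hom]; infer_instance⟩, hb, ?_⟩
  rw [hbk]
  exact isQuasiProjectiveOver_finiteQuotient ρ₀ hqpA

variable {p ρ}
variable (hq : ρ.IsGeometricQuotient p.left) [IsAffineHom p.left]
  (hfree : ∀ (V : Q.left.Opens), IsAffineOpen V → ∀ g : G, g ≠ 1 →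
    Ideal.span (Set.range fun s : Γ(M.left, p.left ⁻¹ᵁ V) ↦ ρ.act g V s - s) = ⊤)

include hq hfree

/-- **DESCENT ALONG A FREE FINITE QUOTIENT OF THE BASE, WITH QUASI-PROJECTIVITY OF THE DESCENDED TOTAL SPACE** (`k : Type`,
e.g. `ℚ`): as `exists_abelianScheme_desc_of_isQuasiProjectiveOver`, and moreover the descended abelian scheme `B → Q` has
total space QUASI-PROJECTIVE over `k` ([MumfordAV1970] §7 Remark p. 69) — the (F) clause «the universal family is
quasi-projective» survives the level-group quotient. [cite: MumfordFogartyKirwan1994, Ch. 7 §3, remark after Thm. 7.9 and Lemma 7.11 (pp. 139–140)]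
[cite: MumfordFogartyKirwan1994, Ch. 7 §1 Prop. 7.1 (p. 127)] [cite: MumfordAV1970, §7 Thm. p. 66 and Remark p. 69] -/
theorem exists_abelianScheme_desc_of_isQuasiProjectiveOver₀ :
    ∃ (B : AbelianSchemeOver Q.left) (π : A.X.left ⟶ B.X.left) (ρA : ActionOver π G),
      (∀ g : G, (ρA.aut g).hom = (autA g).hom) ∧ ρA.IsGeometricQuotient π ∧ IsAffineHom π ∧ IsFinite π ∧
        B.X.left.IsSeparated ∧ A.IsBaseChangeVia B p.left π ∧
          IsQuasiProjectiveOver (Over.mk (B.X.hom ≫ Q.hom) : SchemeOver k) := by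
  obtain ⟨B₀, b, π, ρA, hρA, hπ, haff, hfin, hsep, hb, hqpB⟩ :=
    exists_totalSpace_quotient_of_isQuasiProjectiveOver₀ p ρ A autA hA hqpA
  haveI := haff
  haveI := hsep
  have hA' : ∀ g : G, A.IsBaseChangeVia A (ρ.aut g).hom (ρA.aut g).hom := fun g => by
    rw [hρA g]
    exact hA g
  obtain ⟨grp, hpr, hsm, hgc, hbc⟩ := exists_grpObj_isBaseChangeVia_of_free_base_quotient hq hfree A hπ hA' b hb
  exact ⟨@AbelianSchemeOver.mk Q.left (Over.mk b) grp hpr hsm hgc, π, ρA, hρA, hπ, haff, hfin, hsep, hbc, hqpB⟩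

end SmallField

end Literature.AlgebraicGeometry.AbelianSchemes.AbelianSchemeOver

end
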